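import Summits.AtomisticToContinuum.HydrodynamicLimit.Theorems.TwoClocksClampedEntropyClockKlDivLawAtLocalGibbsNeTop
import HarnessLib

/-!
# Crux `SpeedCapSurgery.CappedEulerLimit` (stmt-AtomisticToContinuum-17739), line `registered`, stub `stub_cappedKlDivNeTop`

THE RELATIVE ENTROPY OF THE EVOLVED RESTRICTED LAW W.R.T. ANY LOCAL GIBBS REFERENCE IS FINITE: for
`0 < σ ≤ 1/2`, continuous positive initial profiles, ANY set `S` of initial data, any time `s` and any local
Gibbs reference with continuous positive profiles, `KL((Φ_s)_*(λ_N|S) ‖ localGibbsLaw σ b w ϑ N Φ) ≠ ∞`.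
The unrestricted statement is the landed `QuenchedCellClock.stub_klDivLawAtLocalGibbsNeTop`; the push-forward
of the restricted law is dominated by the push-forward of the full law (`Measure.map_mono`), and domination
`μ' ≤ μ` by a finite measure preserves `KL(· ‖ ν) ≠ ∞` (`klDiv_ne_top_of_le`: `μ' ≪ μ ≪ ν`, `dμ'/dν ≤ dμ/dν`
a.e., and `|g log g| ≤ 1 + |f log f|` for `0 ≤ g ≤ f`). No measurability of `S` is needed. Worker file of the
lead prover-line-stmt-AtomisticToContinuum-17739-0 (`--supports stmt-AtomisticToContinuum-17739`).

References: H.-T. Yau, *Relative entropy and hydrodynamics of Ginzburg–Landau models*, Lett. Math. Phys. 22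
(1991), §2 (finiteness of the relative entropy along the clock).
-/

noncomputable section

namespace Summit.AtomisticToContinuum.HydrodynamicLimit.Theorems.CappedEulerLimit

open scoped ENNReal NNReal Topology
open MeasureTheory Filter Set InformationTheory
open Literature.Analysis.FluidPDE
open Literature.MathematicalPhysics.KineticTheory

/-! ### §1 Two elementary lemmas: domination preserves finiteness of the relative entropy -/

/-- **Pointwise bound.** For reals `0 ≤ g ≤ f`: `|g log g| ≤ 1 + |f log f|` (on `[0, 1]` the function
`|x log x|` is below `1`, on `[1, ∞)` the function `x log x` is increasing). [folklore] -/
theorem abs_mul_log_le_one_add {g f : ℝ} (hg : 0 ≤ g) (hgf : g ≤ f) :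
    |g * Real.log g| ≤ 1 + |f * Real.log f| := by
  rcases hg.eq_or_lt with rfl | hg0
  · simp only [zero_mul, abs_zero]
    positivity
  rcases le_or_gt g 1 with hg1 | hg1
  · have h := (Real.abs_log_mul_self_lt g hg0 hg1).le
    rw [mul_comm] at h
    exact h.trans (le_add_of_nonneg_right (abs_nonneg _))
  · have hlg : 0 ≤ Real.log g := Real.log_nonneg hg1.le
    have hlf : Real.log g ≤ Real.log f := Real.log_le_log hg0 hgf
    rw [abs_of_nonneg (mul_nonneg hg hlg)]
    calc g * Real.log g ≤ f * Real.log f := mul_le_mul hgf hlf hlg (hg.trans hgf)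
      _ ≤ |f * Real.log f| := le_abs_self _
      _ ≤ 1 + |f * Real.log f| := le_add_of_nonneg_left zero_le_one

/-- **Domination preserves finiteness of the relative entropy.** For finite measures `μ, ν` and any measure
`μ' ≤ μ`: `KL(μ ‖ ν) ≠ ∞ → KL(μ' ‖ ν) ≠ ∞`. Indeed `μ' ≪ μ ≪ ν`, the densities satisfy
`dμ'/dν ≤ dμ/dν` `ν`-a.e., and `|g log g| ≤ 1 + |f log f|` for `0 ≤ g ≤ f` (`abs_mul_log_le_one_add`), so the
`ν`-integrability of `(dμ/dν) log (dμ/dν)` (`integrable_rnDeriv_mul_log_iff`) passes to `μ'`. [folklore] -/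
theorem klDiv_ne_top_of_le {α : Type*} [MeasurableSpace α] {μ μ' ν : Measure α}
    [IsFiniteMeasure μ] [IsFiniteMeasure ν] (hle : μ' ≤ μ) (h : klDiv μ ν ≠ ⊤) :
    klDiv μ' ν ≠ ⊤ := by
  haveI : IsFiniteMeasure μ' := isFiniteMeasure_of_le μ hle
  obtain ⟨hac, hint⟩ := klDiv_ne_top_iff.1 h
  have hac' : μ' ≪ ν := (Measure.absolutelyContinuous_of_le hle).trans hac
  refine klDiv_ne_top hac' ?_
  rw [← integrable_rnDeriv_mul_log_iff hac']
  rw [← integrable_rnDeriv_mul_log_iff hac] at hint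
  -- the densities are ordered `ν`-a.e.
  have hle' : μ'.rnDeriv ν ≤ᵐ[ν] μ.rnDeriv ν := by
    refine ae_le_of_forall_setLIntegral_le_of_sigmaFinite (Measure.measurable_rnDeriv μ' ν)
      fun A _ _ => ?_
    calc ∫⁻ x in A, μ'.rnDeriv ν x ∂ν ≤ μ' A := Measure.setLIntegral_rnDeriv_le A
      _ ≤ μ A := hle A
      _ = ∫⁻ x in A, μ.rnDeriv ν x ∂ν := (Measure.setLIntegral_rnDeriv hac A).symm
  refine ((integrable_const (1 : ℝ)).add hint.abs).mono' ?_ ?_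
  · exact ((Measure.measurable_rnDeriv μ' ν).ennreal_toReal.mul
      (Measure.measurable_rnDeriv μ' ν).ennreal_toReal.log).aestronglyMeasurable
  · filter_upwards [hle', Measure.rnDeriv_ne_top μ ν] with x hx hxt
    rw [Real.norm_eq_abs]
    exact abs_mul_log_le_one_add ENNReal.toReal_nonneg (ENNReal.toReal_mono hxt hx)

/-! ### §2 The stub -/

/-- **Stub `stub_cappedKlDivNeTop` — the relative entropy of the evolved RESTRICTED law w.r.t. any local Gibbs
reference is finite.** For the hard-sphere system on `𝕋³` at reduced diameter `0 < σ ≤ 1/2`, the local Gibbs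
law `λ_N = localGibbsLaw σ a₀ u₀ θ₀ N Φ` (continuous positive profiles) restricted to ANY set `S` of initial
data, any time `s` and any local Gibbs reference `ψ = localGibbsLaw σ b w ϑ N Φ` with continuous positive
profiles: `KL((Φ_s)_*(λ_N|S) ‖ ψ) ≠ ∞`. The push-forward is monotone, so `(Φ_s)_*(λ_N|S) ≤ (Φ_s)_* λ_N`
(`Measure.restrict_le_self`, `Measure.map_mono`); the unrestricted divergence is finite
(`QuenchedCellClock.stub_klDivLawAtLocalGibbsNeTop`), and domination preserves finiteness
(`klDiv_ne_top_of_le`). [cite: Yau1991, §2] -/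
theorem stub_cappedKlDivNeTop {σ : ℝ} (hσ : 0 < σ) (hσ2 : σ ≤ 1 / 2)
    {a₀ θ₀ b ϑ : T3 → ℝ} {u₀ w : T3 → V3}
    (ha : Continuous a₀) (hθ : Continuous θ₀) (hu : Continuous u₀) (ha0 : ∀ x, 0 < a₀ x)
    (hθ0 : ∀ x, 0 < θ₀ x) (hb : Continuous b) (hϑ : Continuous ϑ) (hw : Continuous w)
    (hb0 : ∀ x, 0 < b x) (hϑ0 : ∀ x, 0 < ϑ x)
    (N : ℕ) (Φ : HardSphereFlow (Torus.geometry (Fin 3)) (hsDiameter σ N) (N + 1))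
    (S : Set (Config (N + 1) (Fin 3) T3)) (s : ℝ) :
    klDiv (Φ.lawAt ((localGibbsLaw σ a₀ u₀ θ₀ N Φ).restrict S) s) (localGibbsLaw σ b w ϑ N Φ) ≠ ⊤ := by
  haveI i₀ : IsProbabilityMeasure (localGibbsLaw σ a₀ u₀ θ₀ N Φ) :=
    isProbabilityMeasure_localGibbsLaw ha hθ hu ha0 hθ0 hσ2 N Φ
  haveI i₁ : IsProbabilityMeasure (localGibbsLaw σ b w ϑ N Φ) :=
    isProbabilityMeasure_localGibbsLaw hb hϑ hw hb0 hϑ0 hσ2 N Φ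
  have hfin := QuenchedCellClock.stub_klDivLawAtLocalGibbsNeTop hσ hσ2 ha hθ hu ha0 hθ0 hb hϑ hw hb0 hϑ0
    N Φ s
  rw [HardSphereFlow.lawAt_eq] at hfin ⊢
  exact klDiv_ne_top_of_le (Measure.map_mono Measure.restrict_le_self (Φ.measurable_flow s)) hfin

end Summit.AtomisticToContinuum.HydrodynamicLimit.Theorems.CappedEulerLimit

end
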